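import Summits.QuantumAdvantage.QuantumAdvantage.Theses.CompactnessLift
import Literature.Computability.Complexity.RelativizedTime
import Literature.Computability.Complexity.CircuitClasses
import Literature.Computability.Complexity.StructuralPHProofs
import Literature.Computability.QuantumComplexity.BQTime
import Literature.Computability.QuantumComplexity.OracleSeparationsProofs

/-!
# Strategy census for the crux `LanguageLadder` (stmt-QuantumAdvantage-15271, route CompactnessLift)

Crux-strategist work file (unit `cstrat-stmt-QuantumAdvantage-15271-b1`, 2026-08-17). Companion of
`STRATEGY-CENSUS.md` in the same crux directory: every signature quoted there elaborates here, and
every implication claimed there "by pure logic / by monotonicity" is proved here (no `sorry`).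
Hypotheses that are folklore Turing-machine constructions absent from the tree are NAMED `def`s
(`PaddingCollapse`, `BPPCovered`, `QuadPadding`, `BPTimeMono`, `AdlemanFG`, `QuadPaddingRel`) and
appear explicitly in the theorems that use them — nothing is smuggled.

§0 the crux AS TYPED is the summit (coin-padding collapse; confirms refuter evidence
   `CruxAttack15271.lean` / `CollapseModuloPadding.lean` on the item, re-derived against the real decls);
§1 the refuter's repaired crux `LanguageLadderR` (over `BQTime`/`BPTime`) and its `closes`;
§2 TRANSFER — the two solved siblings in the tree (`kannan`, `exists_oracle_BQPRel_not_subset_BPPRel`)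
   typed next to the step where each transfer breaks;
§3 STRENGTHEN — the quantifier swap and the circuit form, and why each is the summit / Kannan-blocked;
§4 DECOMPOSITION — the rung split and the proof that every co-finite tail IS the crux;
§5 NEGATION — `¬ LanguageLadderR` is a uniform-exponent dequantization, hence `¬ summit`.
-/

namespace Summit.QuantumAdvantage.QuantumAdvantage.Cruxes.LanguageLadder.Census

open Literature.Computability.Complexity Literature.Computability.QuantumComplexity
  Literature.Computability.Cryptography
open Summit.QuantumAdvantage.QuantumAdvantage.Theses.CompactnessLift

/-! ## §0 The crux as typed: `QuadQ ⊄ bp (DTIME n^c)` for every `c` -/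

/-- The route's inlined class `QuadQ` is literally `BQTime (· ^ 2)` (cf. the `example` in `BQTime.lean`). -/
theorem languageLadder_iff :
    LanguageLadder ↔ ∀ c : ℕ, ∃ L ∈ BQTime (fun n => n ^ 2), L ∉ bp (DTIME fun n => n ^ c) :=
  Iff.rfl

/-- **The folklore coin-padding collapse** `BPP ⊆ bp (DTIME n^{c₀})` (NOT in the tree; `bp`'s coin
polynomial is free and `DTIME` clocks on `|boolPair x y|`, so the coins pay for any polynomial running
time — `RelativizedTime.lean`, design note "Why not `bp (DTIME t)`"; proof plan in the item evidence
`PaddingCollapse-plan.md`, target `c₀ = 1`). Used below only as an explicit hypothesis. -/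
def PaddingCollapse (c₀ : ℕ) : Prop :=
  BPP ⊆ bp (DTIME fun n => n ^ c₀)

/-- Easy direction: every rung class lies in `BPP`. -/
theorem bp_DTIME_pow_subset_BPP (c : ℕ) : bp (DTIME fun n => n ^ c) ⊆ BPP :=
  bp_mono fun L hL => Set.mem_iUnion.2 ⟨c, hL⟩

/-- One quadratic-uniform quantum language outside `BPP` gives ALL rungs of the typed ladder. -/
theorem languageLadder_of_exists_not_mem_BPP
    (h : ∃ L ∈ BQTime (fun n => n ^ 2), L ∉ BPP) : LanguageLadder := by
  intro c
  obtain ⟨L, hL, hB⟩ := h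
  exact ⟨L, hL, fun hc => hB (bp_DTIME_pow_subset_BPP c hc)⟩

/-- Modulo the padding collapse, the typed ladder at rung `c₀` already yields a `BQTime (·^2)` language
outside `BPP`. -/
theorem exists_not_mem_BPP_of_languageLadder {c₀ : ℕ} (hpad : PaddingCollapse c₀)
    (h : LanguageLadder) : ∃ L ∈ BQTime (fun n => n ^ 2), L ∉ BPP := by
  obtain ⟨L, hL, hc⟩ := h c₀
  exact ⟨L, hL, fun hB => hc (hpad hB)⟩

/-- The typed ladder has ONE rung: `LanguageLadder ↔ QuadQ ⊄ BPP` (modulo `PaddingCollapse`). -/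
theorem languageLadder_iff_not_subset {c₀ : ℕ} (hpad : PaddingCollapse c₀) :
    LanguageLadder ↔ ¬ (BQTime (fun n => n ^ 2) ⊆ BPP) := by
  constructor
  · intro h hsub
    obtain ⟨L, hL, hB⟩ := exists_not_mem_BPP_of_languageLadder hpad h
    exact hB (hsub hL)
  · intro h
    apply languageLadder_of_exists_not_mem_BPP
    by_contra hne
    exact h fun L hL => by_contra fun hB => hne ⟨L, hL, hB⟩

/-- **BC2 probe `C → S` succeeds (modulo `PaddingCollapse`)**: the crux as typed implies the summit. -/
theorem summit_of_languageLadder {c₀ : ℕ} (hpad : PaddingCollapse c₀) (h : LanguageLadder) :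
    _root_.QuantumAdvantage := by
  obtain ⟨L, hL, hB⟩ := exists_not_mem_BPP_of_languageLadder hpad h
  exact ⟨L, BQTime_pow_subset_BQP 2 hL, hB⟩

/-- … and the route's other crux `CompactnessPrinciple` is then a theorem with no content. -/
theorem compactnessPrinciple_of_paddingCollapse {c₀ : ℕ} (hpad : PaddingCollapse c₀) :
    CompactnessPrinciple := fun hsub =>
  ⟨c₀, fun L hL => hpad (hsub (BQTime_pow_subset_BQP 2 hL))⟩

/-! ## §1 The repaired crux (refuter C′, evidence `CruxAttack15271.lean`) -/

/-- `LanguageLadderR`: for every `c` some `BQTIME(n²)` language lies outside the honest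
`BPTIME(n^c)` of `RelativizedTime.lean` (`O(n^c)` coins, inner machine linear in the padded input). -/
def LanguageLadderR : Prop :=
  ∀ c : ℕ, ∃ L ∈ BQTime (fun n => n ^ 2), L ∉ BPTime (fun n => n ^ c)

/-- `CompactnessPrincipleR`: a dequantization, if it exists, has a uniform exponent on `BQTIME(n²)`. -/
def CompactnessPrincipleR : Prop :=
  BQP ⊆ BPP → ∃ c : ℕ, BQTime (fun n => n ^ 2) ⊆ BPTime (fun n => n ^ c)

/-- The repaired route still decides the summit (same three lines as the route's `closes`). -/
theorem closes_repaired (h₁ : CompactnessPrincipleR) (h₂ : LanguageLadderR) : _root_.QuantumAdvantage := by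
  by_contra hS
  have hsub : BQP ⊆ BPP := fun L hL => by
    by_contra hLB
    exact hS ⟨L, hL, hLB⟩
  obtain ⟨c, hc⟩ := h₁ hsub
  obtain ⟨L, hL, hLc⟩ := h₂ c
  exact hLc (hc hL)

/-- `BPTIME(n^c) ⊆ bp (DTIME n)`: the coin budget `c₁ n^c + c₁` is a polynomial and the inner class is
linear time — so every typed rung class from `c = 1` on swallows every repaired rung class. -/
theorem BPTime_pow_subset_bp_DTIME_id (c : ℕ) : BPTime (fun n => n ^ c) ⊆ bp (DTIME fun n => n) :=
  bpTime_pow_subset_bp _ c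

/-- `bp (DTIME n) ⊆ bp (DTIME n^c)` for `c ≥ 1`. -/
theorem bp_DTIME_id_subset_bp_DTIME_pow {c : ℕ} (hc : 1 ≤ c) :
    bp (DTIME fun n => n) ⊆ bp (DTIME fun n => n ^ c) :=
  bp_mono (DTIME_mono fun n => Nat.le_self_pow (by omega) n)

/-- **Typed ⟹ repaired, unconditionally**: the crux as filed is the STRONGER statement (and, by §0,
summit-strength); the repair weakens it to the intended hypothesis-type ladder. -/
theorem languageLadderR_of_languageLadder (h : LanguageLadder) : LanguageLadderR := by
  intro c
  obtain ⟨L, hL, hno⟩ := h (max c 1)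
  refine ⟨L, hL, fun hB => hno ?_⟩
  exact bp_DTIME_id_subset_bp_DTIME_pow (le_max_right c 1) (BPTime_pow_subset_bp_DTIME_id c hB)

/-- **Quadratic padding** (folklore TM + description-rewriting construction, NOT in the tree; it is the
repaired form of the route's support `SummitGivesLadder`, stmt-15274): a `BQP` language outside `BPP`
pads to a `BQTIME(n²)` language outside `BPP`. Used below only as an explicit hypothesis. -/
def QuadPadding : Prop :=
  _root_.QuantumAdvantage → ∃ L ∈ BQTime (fun n => n ^ 2), L ∉ BPP

/-- The repaired ladder is hypothesis-type as intended: the summit gives it (modulo `QuadPadding`). -/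
theorem languageLadderR_of_summit (hpad : QuadPadding) (hS : _root_.QuantumAdvantage) : LanguageLadderR := by
  intro c
  obtain ⟨L, hL, hB⟩ := hpad hS
  exact ⟨L, hL, fun hc => hB (BPTime_pow_subset_BPP c hc)⟩

/-! ## §2 TRANSFER — the solved siblings and where the transfer breaks -/

/-- **Sibling 1 (same quantifier shape, PROVED in the tree): Kannan's ladder**
`∀ k, ∃ L ∈ Σ₂ᵖ ∩ Π₂ᵖ, L ∉ ⋃ c, SIZE (c n^k + c)` — `kannan_holds`. -/
example : kannan := kannan_holds

/-- The transferred statement: Kannan's ladder with the upper class lowered from `Σ₂ᵖ ∩ Π₂ᵖ` to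
`BQTIME(n²)` — a fixed-polynomial CIRCUIT lower bound for quadratic quantum time. -/
def SizeLadder : Prop :=
  ∀ k : ℕ, ∃ L ∈ BQTime (fun n => n ^ 2), L ∉ ⋃ c : ℕ, SIZE (fun n => c * n ^ k + c)

/-- **Fine-grained Adleman** (folklore, NOT in the tree at fixed exponents; the tree has the polynomial
form `BPP_subset_PPoly_holds`): amplify to error `2^{-2n}` with `O(n)` repetitions and hard-wire the good
coins — `BPTIME(n^c) ⊆ SIZE(O(n^{c+2}))` with room to spare. Explicit hypothesis. -/
def AdlemanFG : Prop :=
  ∀ c : ℕ, BPTime (fun n => n ^ c) ⊆ ⋃ C : ℕ, SIZE (fun n => C * n ^ (c + 2) + C)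

/-- The circuit ladder implies the repaired crux (modulo fine-grained Adleman): so `SizeLadder` is a
STRENGTHENING reached by transferring Kannan's shape (§3 discusses why it buys nothing). -/
theorem languageLadderR_of_sizeLadder (hA : AdlemanFG) (h : SizeLadder) : LanguageLadderR := by
  intro c
  obtain ⟨L, hL, hno⟩ := h (c + 2)
  exact ⟨L, hL, fun hB => hno (hA c hB)⟩

/-- **Sibling 2 (same two classes, PROVED in the tree): the relativized separation**
`∃ A, BQP^A ⊄ BPP^A` — `exists_oracle_BQPRel_not_subset_BPPRel_holds` (Bernstein–Vazirani 1997
Thm 8.10/Cor 8.14; tree proof via Raz–Tal's Forrelation oracle diagonalized against `BPP^A` machines). -/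
example : exists_oracle_BQPRel_not_subset_BPPRel := exists_oracle_BQPRel_not_subset_BPPRel_holds

/-- Its fine-grained form in the time-indexed relativized classes filed for this very route
(`BQTimeRel`, `BPTimeRel`; the typing of the informal item `OracleDichotomy`, stmt-15277). -/
def RelativizedLadder : Prop :=
  ∃ A : Language Bool, ∀ c : ℕ, ∃ L ∈ BQTimeRel A (fun n => n ^ 2),
    L ∉ BPTimeRel (Oracle.ofLanguage A) (fun n => n ^ c)

/-- Relativized quadratic padding (folklore, NOT in the tree): the oracle twin of `QuadPadding`. -/
def QuadPaddingRel : Prop :=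
  ∀ A : Language Bool, ¬ BQPRel A ⊆ BPPRel (Oracle.ofLanguage A) →
    ∃ L ∈ BQTimeRel A (fun n => n ^ 2), L ∉ BPPRel (Oracle.ofLanguage A)

/-- The relativized ladder follows from the proved sibling (modulo relativized padding): the sibling's
version of EXACTLY this step is a theorem. What does not transfer is the removal of `A`
(`STRATEGY-CENSUS.md` §Transfer: the classical lower bound is a QUERY lower bound). -/
theorem relativizedLadder_of_sibling (hpad : QuadPaddingRel)
    (h : exists_oracle_BQPRel_not_subset_BPPRel) : RelativizedLadder := by
  obtain ⟨A, hA⟩ := h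
  obtain ⟨L, hL, hB⟩ := hpad A hA
  exact ⟨A, fun c => ⟨L, hL, fun hc => hB (BPTimeRel_pow_subset_BPPRel _ c hc)⟩⟩

/-! ## §3 STRENGTHEN — the rigid forms and what they cost -/

/-- **S⁺₁, the quantifier swap**: ONE quadratic quantum language outside every `BPTIME(n^c)`. -/
def LadderSwap : Prop :=
  ∃ L ∈ BQTime (fun n => n ^ 2), ∀ c : ℕ, L ∉ BPTime (fun n => n ^ c)

/-- The swap trivially implies the repaired crux … -/
theorem languageLadderR_of_ladderSwap (h : LadderSwap) : LanguageLadderR := by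
  intro c
  obtain ⟨L, hL, hno⟩ := h
  exact ⟨L, hL, hno c⟩

/-- **Coin splitting** `BPP ⊆ ⋃ c, BPTIME(n^c)` (folklore TM construction, NOT in the tree —
`RelativizedTime.lean`, "Not here"). Explicit hypothesis. -/
def BPPCovered : Prop :=
  BPP ⊆ ⋃ c : ℕ, BPTime (fun n => n ^ c)

/-- … but the swap IS `QuadQ ⊄ BPP` (modulo coin splitting) … -/
theorem ladderSwap_iff (hcov : BPPCovered) :
    LadderSwap ↔ ∃ L ∈ BQTime (fun n => n ^ 2), L ∉ BPP := by
  constructor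
  · rintro ⟨L, hL, hno⟩
    refine ⟨L, hL, fun hB => ?_⟩
    obtain ⟨c, hc⟩ := Set.mem_iUnion.1 (hcov hB)
    exact hno c hc
  · rintro ⟨L, hL, hB⟩
    exact ⟨L, hL, fun c hc => hB (BPTime_pow_subset_BPP c hc)⟩

/-- … hence the summit in costume: `LadderSwap → S` (modulo coin splitting) … -/
theorem summit_of_ladderSwap (hcov : BPPCovered) (h : LadderSwap) : _root_.QuantumAdvantage := by
  obtain ⟨L, hL, hB⟩ := (ladderSwap_iff hcov).1 h
  exact ⟨L, BQTime_pow_subset_BQP 2 hL, hB⟩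

/-- … and `S → LadderSwap` (modulo quadratic padding): the only rigid strengthening of the ladder that
admits "one witness for all rungs" is the summit itself. -/
theorem ladderSwap_of_summit (hpad : QuadPadding) (hS : _root_.QuantumAdvantage) : LadderSwap := by
  obtain ⟨L, hL, hB⟩ := hpad hS
  exact ⟨L, hL, fun c hc => hB (BPTime_pow_subset_BPP c hc)⟩

/-- **S⁺₂, explicit witness**: the ladder for ONE named language `L₀` (Shor-padded factoring,
instantiated Forrelation, …) is a special case of the swap, hence at least summit-strength whenever
`L₀ ∈ BQTIME(n²)` is known. -/
def WitnessLadder (L₀ : Language Bool) : Prop :=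
  L₀ ∈ BQTime (fun n => n ^ 2) ∧ ∀ c : ℕ, L₀ ∉ BPTime (fun n => n ^ c)

theorem ladderSwap_of_witnessLadder {L₀ : Language Bool} (h : WitnessLadder L₀) : LadderSwap :=
  ⟨L₀, h.1, h.2⟩

/-- **S⁺₃, the circuit form** is `SizeLadder` of §2 (`languageLadderR_of_sizeLadder`). -/
example (hA : AdlemanFG) : SizeLadder → LanguageLadderR := languageLadderR_of_sizeLadder hA

/-! ## §4 DECOMPOSITION — the rung split, and why every tail is the whole crux -/

/-- Rung `c` of the repaired ladder. -/
def Rung (c : ℕ) : Prop :=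
  ∃ L ∈ BQTime (fun n => n ^ 2), L ∉ BPTime (fun n => n ^ c)

/-- The tail of the ladder from `c₀` on. -/
def TailFrom (c₀ : ℕ) : Prop :=
  ∀ c : ℕ, c₀ ≤ c → Rung c

theorem languageLadderR_iff_forall_rung : LanguageLadderR ↔ ∀ c : ℕ, Rung c :=
  Iff.rfl

/-- The typed split `Rung 0 → TailFrom 1 → LanguageLadderR` (glue, sorry-free). `Rung 0` — quadratic
quantum time versus randomized linear time with `O(1)` coins — is the one piece provable in principle
(deterministic time hierarchy + reversible compilation; content-free), see `STRATEGY-CENSUS.md`. -/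
theorem languageLadderR_of_split (h₀ : Rung 0) (h : TailFrom 1) : LanguageLadderR := by
  intro c
  rcases Nat.eq_zero_or_pos c with rfl | hc
  · exact h₀
  · exact h c hc

/-- **Rung monotonicity** `BPTIME(n^c) ⊆ BPTIME(n^{c'})` for `c ≤ c'` (folklore coin-truncation TM
construction, NOT in the tree: `bpTime` fixes the coin length EXACTLY, so enlarging it needs the
inner machine to ignore a computable suffix). Explicit hypothesis. -/
def BPTimeMono : Prop :=
  ∀ c c' : ℕ, c ≤ c' → BPTime (fun n => n ^ c) ⊆ BPTime (fun n => n ^ c')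

/-- A higher rung implies every lower rung (modulo rung monotonicity). -/
theorem rung_anti (hm : BPTimeMono) {c c' : ℕ} (hcc : c ≤ c') (h : Rung c') : Rung c := by
  obtain ⟨L, hL, hno⟩ := h
  exact ⟨L, hL, fun hc => hno (hm c c' hcc hc)⟩

/-- **Degeneracy of every rung split**: any tail `TailFrom c₀` alone IS the crux — so in the split
`Rung 0 ∧ … ∧ Rung (c₀-1) ∧ TailFrom c₀` the last piece is the crux reworded (not an admissible
decomposition), whatever `c₀`. -/
theorem languageLadderR_of_tail (hm : BPTimeMono) (c₀ : ℕ) (h : TailFrom c₀) : LanguageLadderR := by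
  intro c
  exact rung_anti hm (le_max_left c c₀) (h (max c c₀) (le_max_right c c₀))

/-- Likewise any INFINITE set of rungs is the crux: "infinitely often" buys nothing. -/
theorem languageLadderR_of_frequently (hm : BPTimeMono) (h : ∀ c₀ : ℕ, ∃ c, c₀ ≤ c ∧ Rung c) :
    LanguageLadderR := by
  intro c
  obtain ⟨c', hcc, hr⟩ := h c
  exact rung_anti hm hcc hr

/-! ## §5 NEGATION — a counterexample is a uniform-exponent dequantization -/

/-- `¬ LanguageLadderR` says: ONE classical exponent `c` simulates all of `BQTIME(n²)`. -/
theorem not_languageLadderR_iff :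
    ¬ LanguageLadderR ↔ ∃ c : ℕ, BQTime (fun n => n ^ 2) ⊆ BPTime (fun n => n ^ c) := by
  constructor
  · intro h
    by_contra hne
    apply h
    intro c
    by_contra hc
    exact hne ⟨c, fun L hL => by_contra fun hLB => hc ⟨L, hL, hLB⟩⟩
  · rintro ⟨c, hc⟩ h
    obtain ⟨L, hL, hLB⟩ := h c
    exact hLB (hc hL)

/-- … which refutes the summit (modulo quadratic padding): building a counterexample to the crux is at
least as hard as proving `BQP ⊆ BPP`, and strictly more (it must come with ONE exponent). -/
theorem not_summit_of_not_languageLadderR (hpad : QuadPadding) (h : ¬ LanguageLadderR) :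
    ¬ _root_.QuantumAdvantage := by
  intro hS
  obtain ⟨c, hc⟩ := not_languageLadderR_iff.1 h
  obtain ⟨L, hL, hB⟩ := hpad hS
  exact hB (BPTime_pow_subset_BPP c (hc hL))

/-- Conversely `¬ S` does NOT give `¬ LanguageLadderR`: the gap is exactly the repaired compactness
principle (pure logic) — the negation side of the crux is the route's OTHER crux. -/
theorem compactnessPrincipleR_iff :
    CompactnessPrincipleR ↔ (BQP ⊆ BPP → ¬ LanguageLadderR) := by
  constructor
  · intro h hsub hL
    obtain ⟨c, hc⟩ := h hsub
    obtain ⟨L, hL', hLc⟩ := hL c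
    exact hLc (hc hL')
  · intro h hsub
    exact not_languageLadderR_iff.1 (h hsub)

end Summit.QuantumAdvantage.QuantumAdvantage.Cruxes.LanguageLadder.Census
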